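import Mathlib
import Summits.MatrixMultiplication.MatrixMultiplication.Theorems.FidelityWitnessesFidelityThesisSepMajorantSingleProduct

/-!
# Line `separable-majorant` for crux `FidelityWitnesses.FidelityThesis` (stmt-MatrixMultiplication-4956) —
stub `stub_separableMajorantLaw`: the SEPARABLE MAJORANT LAW

Conventions (tree `matMulTensor`): slots `a = (κ,ν)` (output), `b = (κ,μ)`, `c = (μ',ν)` in `Fin n × Fin n`,
`⟨n,n,n⟩(a,b,c) = [a.1 = b.1 ∧ b.2 = c.1 ∧ a.2 = c.2]`, output slices `T_a := ⟨n,n,n⟩(a,·,·)`.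

Statement.  Let `S = Σ_l w_l ⊗ u_l ⊗ v_l` (`r` triads) and let `σ = Σ_k p_k (φ_k ⊗ ψ_k)(φ_k ⊗ ψ_k)^*` be a
nonnegative separable mixture of sub-normalised total weight `Σ_k p_k ‖φ_k‖² ‖ψ_k‖² ≤ 1`.  If the product
span `E = span{u_l ⊗ v_l}` is majorised by `λ σ` in the projector-free form

  `|Σ_{bc} y(b,c) z(b,c)|² ≤ λ ‖y‖² · Σ_k p_k |Σ_{bc} φ_k(b) ψ_k(c) z(b,c)|²`  (`y = Σ_l d_l u_l ⊗ v_l ∈ E`, all `z`),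

then `|⟨S, ⟨n,n,n⟩⟩|² ≤ λ ‖S‖²`.

Proof.  Slice by slice, `⟨S, ⟨n,n,n⟩⟩ = Σ_a Y_a` with `Y_a = ⟨y_a, T_a⟩`, `y_a = Σ_l w_l(a) u_l ⊗ v_l`, and
`‖S‖² = Σ_a N_a`, `N_a = ‖y_a‖²`.  The hypothesis at `(d, z) = (w_·(a), T_a)` gives `|Y_a|² ≤ λ N_a q_a` with
`q_a = Σ_k p_k |⟨φ_k ⊗ ψ_k, T_a⟩|²`; the weighted Cauchy–Schwarz inequality over `a`
(`Finset.sum_sq_le_sum_mul_sum_of_sq_le_mul`) gives `(Σ_a |Y_a|)² ≤ λ (Σ_a N_a) (Σ_a q_a)`, and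
`Σ_a q_a = Σ_k p_k Σ_a |⟨φ_k ⊗ ψ_k, T_a⟩|² ≤ Σ_k p_k ‖φ_k‖² ‖ψ_k‖² ≤ 1` by the single-product law
(`sepMajorant_singleProductLaw`, toolkit I): a unit product sees at most one unit of `⟨n,n,n⟩`.
Idea card `Cruxes/FidelityThesis/Ideas/separable-majorant-law.md`, § Lever.  Supports item
`stmt-MatrixMultiplication-4956`; no definitions.
-/

namespace Summit.MatrixMultiplication.MatrixMultiplication.Theorems

open scoped BigOperators ComplexConjugate
open Literature.Computability.AlgebraicComplexity

/-- The separable weights of the output slices of `⟨n,n,n⟩` sum to at most the total weight of `σ`: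
`Σ_a Σ_k p_k |⟨φ_k ⊗ ψ_k, T_a⟩|² ≤ Σ_k p_k ‖φ_k‖² ‖ψ_k‖²` for `p ≥ 0` — the single-product law
`sepMajorant_singleProductLaw` summed against the mixture weights. [folklore] -/
theorem sepMajorantSML_sliceWeight_le {n m : ℕ} (p : Fin m → ℝ) (φ ψ : Fin m → Fin n × Fin n → ℂ)
    (hp : ∀ k, 0 ≤ p k) :
    ∑ a : Fin n × Fin n, ∑ k, p k * ‖∑ b, ∑ c, φ k b * ψ k c * matMulTensor ℂ n n n a b c‖ ^ 2 ≤
      ∑ k, p k * ((∑ b, ‖φ k b‖ ^ 2) * ∑ c, ‖ψ k c‖ ^ 2) := by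
  rw [Finset.sum_comm]
  refine Finset.sum_le_sum fun k _ => ?_
  rw [← Finset.mul_sum]
  exact mul_le_mul_of_nonneg_left (sepMajorant_singleProductLaw (φ k) (ψ k)) (hp k)

/-- **Separable majorant law.**  For `r` products `u_l ⊗ v_l` of the two input legs, a nonnegative finite
mixture `σ = Σ_k p_k (φ_k ⊗ ψ_k)(φ_k ⊗ ψ_k)^*` of sub-normalised total weight (`Σ_k p_k ‖φ_k‖²‖ψ_k‖² ≤ 1`)
and `λ ≥ 0` such that the product span is majorised by `λσ` in the projector-free form
`|Σ_{bc} y(b,c) z(b,c)|² ≤ λ · ‖y‖² · Σ_k p_k |Σ_{bc} φ_k(b)ψ_k(c) z(b,c)|²` for every `y = Σ_l d_l u_l ⊗ v_l`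
in the span and every `z`: every tensor `S = Σ_l w_l ⊗ u_l ⊗ v_l` with that input frame has
`|⟨S,⟨n,n,n⟩⟩|² ≤ λ·‖S‖²`.  (Hypothesis on each output slice, weighted Cauchy–Schwarz over the output
slot, and `sepMajorantSML_sliceWeight_le`.) [folklore] -/
theorem stub_separableMajorantLaw {n r m : ℕ} (w u v : Fin r → Fin n × Fin n → ℂ)
    (p : Fin m → ℝ) (φ ψ : Fin m → Fin n × Fin n → ℂ) (lam : ℝ) (hlam : 0 ≤ lam)
    (hp : ∀ k, 0 ≤ p k)
    (htr : ∑ k, p k * ((∑ b, ‖φ k b‖ ^ 2) * ∑ c, ‖ψ k c‖ ^ 2) ≤ 1)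
    (hmaj : ∀ (d : Fin r → ℂ) (z : Fin n × Fin n → Fin n × Fin n → ℂ),
      ‖∑ b, ∑ c, (∑ l, d l * u l b * v l c) * z b c‖ ^ 2 ≤
        lam * (∑ b, ∑ c, ‖∑ l, d l * u l b * v l c‖ ^ 2) *
          ∑ k, p k * ‖∑ b, ∑ c, φ k b * ψ k c * z b c‖ ^ 2) :
    ‖∑ a, ∑ b, ∑ c, (∑ l, w l a * u l b * v l c) * matMulTensor ℂ n n n a b c‖ ^ 2 ≤
      lam * ∑ a, ∑ b, ∑ c, ‖∑ l, w l a * u l b * v l c‖ ^ 2 := by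
  -- output slices `Y a = ⟨y_a, T_a⟩`, their weights `N a = ‖y_a‖²`, and the separable weights `q a`
  set Y : Fin n × Fin n → ℂ := fun a =>
    ∑ b, ∑ c, (∑ l, w l a * u l b * v l c) * matMulTensor ℂ n n n a b c
  set N : Fin n × Fin n → ℝ := fun a => ∑ b, ∑ c, ‖∑ l, w l a * u l b * v l c‖ ^ 2
  set q : Fin n × Fin n → ℝ := fun a =>
    ∑ k, p k * ‖∑ b, ∑ c, φ k b * ψ k c * matMulTensor ℂ n n n a b c‖ ^ 2
  -- (ii) the majorant hypothesis on each output slice: `|Y_a|² ≤ λ N_a q_a`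
  have hslice : ∀ a, ‖Y a‖ ^ 2 ≤ lam * N a * q a := fun a =>
    hmaj (fun l => w l a) (fun b c => matMulTensor ℂ n n n a b c)
  have hN0 : ∀ a, 0 ≤ N a := fun a =>
    Finset.sum_nonneg fun b _ => Finset.sum_nonneg fun c _ => by positivity
  have hq0 : ∀ a, 0 ≤ q a := fun a =>
    Finset.sum_nonneg fun k _ => mul_nonneg (hp k) (by positivity)
  have hNsum0 : 0 ≤ ∑ a, N a := Finset.sum_nonneg fun a _ => hN0 a
  -- (v) the separable weights sum to at most one (single-product law against `p`, then `htr`)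
  have hqsum : ∑ a, q a ≤ 1 := (sepMajorantSML_sliceWeight_le p φ ψ hp).trans htr
  -- (iv) weighted Cauchy–Schwarz over the output slot `a`
  have hCS : (∑ a, ‖Y a‖) ^ 2 ≤ (∑ a, lam * N a) * ∑ a, q a :=
    Finset.sum_sq_le_sum_mul_sum_of_sq_le_mul Finset.univ
      (fun a _ => mul_nonneg hlam (hN0 a)) (fun a _ => hq0 a) (fun a _ => hslice a)
  -- (vi) assemble
  calc ‖∑ a, Y a‖ ^ 2 ≤ (∑ a, ‖Y a‖) ^ 2 := pow_le_pow_left₀ (norm_nonneg _) (norm_sum_le _ _) 2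
    _ ≤ (∑ a, lam * N a) * ∑ a, q a := hCS
    _ = lam * (∑ a, N a) * ∑ a, q a := by rw [← Finset.mul_sum]
    _ ≤ lam * (∑ a, N a) * 1 := mul_le_mul_of_nonneg_left hqsum (mul_nonneg hlam hNsum0)
    _ = lam * ∑ a, N a := mul_one _

end Summit.MatrixMultiplication.MatrixMultiplication.Theorems
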